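import Literature.MathematicalPhysics.QuantumFieldTheory.BalabanImbrieJaffe1984to88.BIJ88Sect2Statements

/-!
# `BalabanImbrieJaffe1984to88.BIJ88Close218Proof` — T. Bałaban, J. Imbrie, A. Jaffe, *Effective action and cluster properties
of the abelian Higgs model*, Commun. Math. Phys. **114** (1988) 257–315 [BalabanImbrieJaffe1988]: the hence-steps of p. 262 —
(2.16) ⟹ (2.18) and *"(2.16), (2.17) hold for σ_{k,loc}, and σ_{k,loc} ≧ c > 0 (2.19) as well"* for the sharp truncation (2.14);
*"C_{k,loc} also satisfies (2.23)"* and (2.23)+(2.24) ⟹ (2.26) for the smooth cutoff (2.25) — PROVED as kernel algebra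

statement-level skeleton of published theorems with citation tags; proofs where landed; nothing here is a claim about the Yang–Mills mass gap

PDF held: `paper:balaban1988-cmp114-bij-abelian-higgs-effective-action` (journal page = PDF page + 256); pp. 261–262 [PDF 5–6]
read this session from the text layer (`lit read … --pages 5-6`).

WHAT IS REPRODUCED.  SKELETON rows **C2.Eq2.18**, **C2.Eq2.19**, **C2.Eq2.26** (and the inheritance sentences attached to
**C2.Eq2.16**, **C2.Eq2.17**, **C2.Eq2.23**) (cell `lit-balaban`, HOME `run/shared/lean/pub/lit-balaban/`; Phase-2 seat p02 gen 3 =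
unit `lit-balaban-p02`, G.2(b)/(c) knitting steps; C2 §§1–4 fold owner r18, referee ref-5; TAKING line HOME/STATUS.md
2026-08-21T04:20:20Z; companion of `BIJ88Close235Proof` (p248026), independent of it).  Before this file (2.18), (2.19), (2.26)
were the bare `def … : Prop`s `BIJ88Sect2Statements.Close` / `Ineq219` (typed p239939).
p. 261–262, verbatim: *"As before we construct a localized operator on T₁^{(k)} from σ_k on T₁^{(k)}: σ_{k,loc}(p₁,p₂) = σ_k(p₁,p₂)
if dist(p₁,p₂) ≦ (1/2L) r(e_{k−1}), 0, otherwise, (2.14) … we see that |σ_k(p₁,p₂)| ≦ ce^{−c dist(p₁,p₂)} for dist(p₁,p₂) ≧ c.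
(2.16) … Then we prove that (σ_kf^{(k)})(p₁) ≦ ‖f^{(k)}‖_∞ (2.17) … It was also shown in [2] that σ_k is bounded from below. In view
of (2.16) we have that |σ_{k,loc}(p₁,p₂) − σ_k(p₁,p₂)| ≦ ce^{−cr(e_k)}e^{−c dist(p₁,p₂)}, (2.18) so that (2.16), (2.17) hold for
σ_{k,loc}, and σ_{k,loc} ≧ c > 0 (2.19) as well. … |C_k(x,b′)| ≦ ce^{−c dist(x,b′)}, dist(x,b′) > c. (2.23) … The localized version of
C_k is defined using another smooth cutoff: ζ′_k(x,b′) = 1, for dist(x,b′) ≦ ¼r(e_k), 0, for dist(x,b′) ≧ ½r(e_k). (2.24) We then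
construct C_{k,loc} on T^{(k)}_η from C_k on T^{(k)}_η: C_{k,loc}(x,b′) = ζ′_k(x,b′)C_k(x,b′). (2.25) Then C_{k,loc} also satisfies
(2.23) and |C_{k,loc}(x,b′) − C_k(x,b′)| ≦ e^{−cr(e_k)}e^{−c dist(x,b′)}. (2.26)"*

WHAT IS PROVED HERE (0 `sorry`, standard axioms; theorems only, over r18's abstract kernel carriers).
§1 THE SHARP TRUNCATION (2.14) (`BIJ88Sect2Statements.trunc`).  **(2.16) ⟹ (2.18)** `close_trunc_of_decayFar`: `DecayFar dist σ c`
(decay beyond the threshold `c`) and a truncation radius `R ≥ c` give `|σ_loc − σ| ≤ (ce^{−(c/2)R})·e^{−(c/2)dist}` — r18's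
`Close … (ce^{−(c/2)R}) (c/2)`; at the printed radius `R = (1/2L)r(e_{k−1})`: **`close218`** (print absorbs `ce^{−(c/4L)r(e_{k−1})}` into
`ce^{−cr(e_k)}`); *"(2.16) holds for σ_{k,loc}"*: `decayFar_trunc`; *"(2.17) holds for σ_{k,loc}"*: `ineq217_trunc` (truncating the
kernel = restricting the test function to the ball, `applyK_trunc`; the abstract side condition `Near` of r18's `Ineq217` must be
stable under that restriction — hypothesis `hNear`, true for the printed *"f^{(k)}(p₂) = (∂A)(p₂) for p₂ near p₁"*);
**(2.19) for σ_{k,loc}** `ineq219_of_close`: from `Ineq219 σ c₀` ([2] Thm 7.1.1, a statement row) and any closeness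
`Close dist σ_loc σ δ c′` with summable weights `Σ_b e^{−c′dist(a,b)} ≤ S` (symmetric `dist`), `σ_loc ≥ c₀ − δS` as a quadratic form
(the symmetric Schur bound `abs_form_le_of_kernel_bound`: `|⟨f,(σ_loc − σ)f⟩| ≤ δS‖f‖²`), positive when `δS < c₀`.
§2 THE SMOOTH CUTOFF (2.24)–(2.25) (`BIJ88Sect2Statements.loc`, `IsCutoff`/`Zeta224`).  *"C_{k,loc} also satisfies (2.23)"*:
`decayFar_loc` (0 ≤ ζ′ ≤ 1); **(2.23)+(2.24) ⟹ (2.26)** `close_loc_of_decayFar` (the mechanism of r18's `loc_close` with the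
threshold decay `DecayFar` in place of `Decay`, legitimate because `ζ′ = 1` within `R₁ ≥ c`): `|C_loc − C| ≤ (ce^{−(c/2)R₁})e^{−(c/2)dist}`;
at the printed radii of `Zeta224` (`R₁ = ¼r(e_k)`): **`close226`** with `δ = ce^{−(c/8)r(e_k)}`.
HONEST SCOPE.  (2.16), (2.17), (2.23) and the lower bound of σ_k ([2] Thm 7.1.1) remain statement rows and enter only as the displayed
hypotheses `DecayFar` / `Ineq217` / `Ineq219`; constants are explicit and become print's generic `c` only by the stated absorptions;
r18's real-kernel typing; nothing on d = 4 or the continuum; NOT summit progress.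

v1.1 (append-only, same seat): §3 — the inheritance sentence of **C2.Eq2.5** p. 260, *"|H_{k,loc}(b,b′)| ≦ ce^{−c dist(b,b′)}; (2.5)
see (I.7.2.2)"*: a cutoff `0 ≤ ζ ≤ 1` preserves everywhere-decay with the same constant (`decay_loc`; (2.5) from (I.7.2.2) for H_k and
(2.4)); everywhere-decay implies threshold decay (`decayFar_of_decay`), so §1 applies to everywhere-decaying kernels too
(`close_trunc_of_decay`).
-/

namespace Literature.MathematicalPhysics.QuantumFieldTheory.BalabanImbrieJaffe1984to88.BIJ88Close218Proof

open Finset BIJ88Sect2Statements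

noncomputable section

variable {α β : Type*}

/-! ## §1  The sharp truncation (2.14): (2.16) ⟹ (2.18), (2.16)/(2.17) for σ_{k,loc}, (2.19) -/

/-- **(2.16) ⟹ (2.18), the mechanism with explicit constants**: if `|σ(p₁,p₂)| ≦ ce^{−c dist}` for `dist ≧ c` and the truncation
radius is `R ≥ c`, then `|σ_loc(p₁,p₂) − σ(p₁,p₂)| ≦ (ce^{−(c/2)R})·e^{−(c/2)dist(p₁,p₂)}` (`σ_loc − σ` lives where `dist > R`).
[cite: BalabanImbrieJaffe1988, (2.18) p.262] -/
theorem close_trunc_of_decayFar {dist : α → β → ℝ} {K : α → β → ℝ} {c R : ℝ} (hc : 0 ≤ c) (hcR : c ≤ R)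
    (hK : DecayFar dist K c) : Close dist (trunc dist R K) K (c * Real.exp (-(c / 2) * R)) (c / 2) := by
  intro a b
  by_cases hab : dist a b ≤ R
  · simp only [trunc, if_pos hab, sub_self, abs_zero]
    positivity
  · rw [not_le] at hab
    simp only [trunc, if_neg (not_le.2 hab), zero_sub, abs_neg]
    refine (hK a b (by linarith)).trans ?_
    rw [mul_assoc, ← Real.exp_add]
    gcongr
    nlinarith

/-- **(2.18) at the printed radius** of (2.14), `R = (1/2L) r(e_{k−1})` (`rekm1` = r(e_{k−1})): `δ = ce^{−(c/2)(1/2L)r(e_{k−1})}`,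
rate `c/2` (print writes `ce^{−cr(e_k)}e^{−c dist}` with a generic c). [cite: BalabanImbrieJaffe1988, (2.18) p.262] -/
theorem close218 {dist : α → β → ℝ} {σ : α → β → ℝ} {c L rekm1 : ℝ} (hc : 0 ≤ c) (hcR : c ≤ rekm1 / (2 * L))
    (h216 : DecayFar dist σ c) :
    Close dist (trunc dist (rekm1 / (2 * L)) σ) σ (c * Real.exp (-(c / 2) * (rekm1 / (2 * L)))) (c / 2) :=
  close_trunc_of_decayFar hc hcR h216

/-- *"(2.16) hold[s] for σ_{k,loc}"*: the truncation inherits the threshold decay (2.16) with the same constant.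
[cite: BalabanImbrieJaffe1988, (2.16) p.261] -/
theorem decayFar_trunc {dist : α → β → ℝ} {K : α → β → ℝ} {c : ℝ} (R : ℝ) (hc : 0 ≤ c) (hK : DecayFar dist K c) :
    DecayFar dist (trunc dist R K) c := by
  intro a b hab
  by_cases h : dist a b ≤ R
  · simp only [trunc, if_pos h]
    exact hK a b hab
  · simp only [trunc, if_neg h, abs_zero]
    positivity

/-- Truncating the kernel at radius `R` around the output point = restricting the test function to that ball.
[cite: BalabanImbrieJaffe1988, (2.14) p.261] -/
theorem applyK_trunc [Fintype α] (dist : β → α → ℝ) (R : ℝ) (σ : β → α → ℝ) (f : α → ℝ) (p₁ : β) :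
    applyK (trunc dist R σ) f p₁ = applyK σ (fun p₂ => if dist p₁ p₂ ≤ R then f p₂ else 0) p₁ := by
  simp only [applyK, trunc]
  refine Finset.sum_congr rfl fun p₂ _ => ?_
  split_ifs <;> simp

/-- Restricting a function to a ball does not increase `‖·‖_∞`. [cite: BalabanImbrieJaffe1988, (2.17) p.262] -/
theorem supNorm_restrict_le [Fintype α] (dist : β → α → ℝ) (R : ℝ) (f : α → ℝ) (p₁ : β) :
    supNorm (fun p₂ => if dist p₁ p₂ ≤ R then f p₂ else 0) ≤ supNorm f := by
  refine Real.iSup_le (fun p₂ => ?_) (Real.iSup_nonneg fun a => abs_nonneg (f a))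
  show |(if dist p₁ p₂ ≤ R then f p₂ else 0)| ≤ supNorm f
  split_ifs
  · exact le_ciSup (Finite.bddAbove_range fun a => |f a|) p₂
  · rw [abs_zero]
    exact Real.iSup_nonneg fun a => abs_nonneg (f a)

/-- *"(2.17) hold[s] for σ_{k,loc}"*: `(σ_{k,loc}f)(p₁) = (σ_k(f·1_{dist(p₁,·) ≤ R}))(p₁) ≦ ‖f·1‖_∞ ≦ ‖f‖_∞`, provided the side
condition of (2.17) (*"f^{(k)}(p₂) = (∂A)(p₂) for p₂ near p₁"*, r18's abstract `Near`) is stable under restriction to the ball.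
[cite: BalabanImbrieJaffe1988, (2.17) p.262] -/
theorem ineq217_trunc [Fintype α] {dist : α → α → ℝ} {R : ℝ} {σ : α → α → ℝ} {Near : α → (α → ℝ) → Prop}
    (h217 : Ineq217 σ Near) (hNear : ∀ p₁ f, Near p₁ f → Near p₁ (fun p₂ => if dist p₁ p₂ ≤ R then f p₂ else 0)) :
    Ineq217 (trunc dist R σ) Near := by
  intro f p₁ hf
  rw [applyK_trunc]
  exact (h217 _ p₁ (hNear p₁ f hf)).trans (supNorm_restrict_le dist R f p₁)

/-- **Symmetric Schur bound**: a kernel dominated by `δe^{−c′dist}` (symmetric `dist`, row sums of the weight `≤ S`) has quadratic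
form `|⟨f, Mf⟩| ≤ δS‖f‖²` — the step behind *"σ_{k,loc} ≧ c > 0 as well"*. [cite: BalabanImbrieJaffe1988, (2.19) p.262] -/
theorem abs_form_le_of_kernel_bound [Fintype α] {dist : α → α → ℝ} {M : α → α → ℝ} {δ c' S : ℝ}
    (hM : ∀ a b, |M a b| ≤ δ * Real.exp (-c' * dist a b)) (hsymm : ∀ a b, dist a b = dist b a)
    (hS : ∀ a, ∑ b, Real.exp (-c' * dist a b) ≤ S) (hδ : 0 ≤ δ) (f : α → ℝ) :
    |∑ a, f a * applyK M f a| ≤ δ * S * ∑ a, f a ^ 2 := by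
  set w : α → α → ℝ := fun a b => δ * Real.exp (-c' * dist a b) with hw
  have hwsymm : ∀ a b, w a b = w b a := fun a b => by simp only [hw, hsymm a b]
  have hwrow : ∀ a, ∑ b, w a b ≤ δ * S := fun a => by
    rw [← Finset.mul_sum]
    exact mul_le_mul_of_nonneg_left (hS a) hδ
  have hexp : ∑ a, f a * applyK M f a = ∑ a, ∑ b, f a * (M a b * f b) := by
    simp only [applyK, Finset.mul_sum]
  -- T ≤ U: the AM–GM step with the symmetry of the weight
  have hTU : ∑ a, ∑ b, w a b * (|f a| * |f b|) ≤ ∑ a, ∑ b, w a b * f a ^ 2 := by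
    have hU : ∑ a, ∑ b, w a b * f b ^ 2 = ∑ a, ∑ b, w a b * f a ^ 2 := by
      rw [Finset.sum_comm]
      exact Finset.sum_congr rfl fun a _ => Finset.sum_congr rfl fun b _ => by rw [hwsymm b a]
    have h2T : 2 * (∑ a, ∑ b, w a b * (|f a| * |f b|))
        ≤ (∑ a, ∑ b, w a b * f a ^ 2) + ∑ a, ∑ b, w a b * f b ^ 2 := by
      rw [← Finset.sum_add_distrib, Finset.mul_sum]
      refine Finset.sum_le_sum fun a _ => ?_
      rw [← Finset.sum_add_distrib, Finset.mul_sum]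
      refine Finset.sum_le_sum fun b _ => ?_
      have h3 : 0 ≤ w a b := by positivity
      nlinarith [sq_nonneg (|f a| - |f b|), sq_abs (f a), sq_abs (f b), h3]
    linarith
  rw [hexp]
  calc |∑ a, ∑ b, f a * (M a b * f b)|
      ≤ ∑ a, ∑ b, |f a * (M a b * f b)| :=
        (Finset.abs_sum_le_sum_abs _ _).trans (Finset.sum_le_sum fun a _ => Finset.abs_sum_le_sum_abs _ _)
    _ ≤ ∑ a, ∑ b, w a b * (|f a| * |f b|) := by
        refine Finset.sum_le_sum fun a _ => Finset.sum_le_sum fun b _ => ?_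
        rw [abs_mul, abs_mul]
        calc |f a| * (|M a b| * |f b|) = |M a b| * (|f a| * |f b|) := by ring
          _ ≤ w a b * (|f a| * |f b|) := mul_le_mul_of_nonneg_right (hM a b) (by positivity)
    _ ≤ ∑ a, ∑ b, w a b * f a ^ 2 := hTU
    _ = ∑ a, f a ^ 2 * ∑ b, w a b := by
        refine Finset.sum_congr rfl fun a _ => ?_
        rw [Finset.mul_sum]
        exact Finset.sum_congr rfl fun b _ => by ring
    _ ≤ ∑ a, f a ^ 2 * (δ * S) := Finset.sum_le_sum fun a _ => mul_le_mul_of_nonneg_left (hwrow a) (sq_nonneg _)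
    _ = δ * S * ∑ a, f a ^ 2 := by rw [← Finset.sum_mul]; ring

/-- **(2.19) for σ_{k,loc}**, *"It was also shown in [2] that σ_k is bounded from below. In view of (2.16) we have (2.18) so that …
σ_{k,loc} ≧ c > 0 (2.19) as well"*: from `σ_k ≥ c₀` as a quadratic form and the closeness (2.18) with weight row sums `≤ S`,
`σ_{k,loc} ≥ c₀ − δS > 0`. [cite: BalabanImbrieJaffe1988, (2.19) p.262] -/
theorem ineq219_of_close [Fintype α] {dist : α → α → ℝ} {σloc σ : α → α → ℝ} {c₀ δ c' S : ℝ}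
    (h219 : Ineq219 σ c₀) (h218 : Close dist σloc σ δ c') (hsymm : ∀ a b, dist a b = dist b a)
    (hS : ∀ a, ∑ b, Real.exp (-c' * dist a b) ≤ S) (hδ : 0 ≤ δ) (hsmall : δ * S < c₀) :
    Ineq219 σloc (c₀ - δ * S) := by
  refine ⟨by linarith, fun f => ?_⟩
  have hform := abs_form_le_of_kernel_bound (M := fun a b => σloc a b - σ a b) h218 hsymm hS hδ f
  have hsplit : ∑ p, f p * applyK σloc f p
      = ∑ p, f p * applyK σ f p + ∑ p, f p * applyK (fun a b => σloc a b - σ a b) f p := by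
    rw [← Finset.sum_add_distrib]
    refine Finset.sum_congr rfl fun p _ => ?_
    rw [← mul_add]
    congr 1
    simp only [applyK, ← Finset.sum_add_distrib]
    exact Finset.sum_congr rfl fun a _ => by ring
  rw [hsplit]
  have h1 := h219.2 f
  have h2 := neg_le_of_abs_le hform
  have h3 : (c₀ - δ * S) * ∑ p, f p ^ 2 = c₀ * ∑ p, f p ^ 2 - δ * S * ∑ p, f p ^ 2 := by ring
  linarith

/-! ## §2  The smooth cutoff (2.24)–(2.25): (2.23) for C_{k,loc}, (2.23)+(2.24) ⟹ (2.26) -/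

/-- *"Then C_{k,loc} also satisfies (2.23)"*: a cutoff with `0 ≤ ζ′ ≤ 1` preserves the threshold decay, same constant.
[cite: BalabanImbrieJaffe1988, (2.23) p.262] -/
theorem decayFar_loc {dist : α → β → ℝ} {ζ K : α → β → ℝ} {c : ℝ} (h01 : ∀ a b, 0 ≤ ζ a b ∧ ζ a b ≤ 1)
    (hK : DecayFar dist K c) : DecayFar dist (loc ζ K) c := by
  intro a b hab
  have hz : |ζ a b| ≤ 1 := by
    rw [abs_le]
    constructor <;> linarith [(h01 a b).1, (h01 a b).2]
  calc |loc ζ K a b| = |ζ a b| * |K a b| := abs_mul _ _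
    _ ≤ 1 * |K a b| := mul_le_mul_of_nonneg_right hz (abs_nonneg _)
    _ = |K a b| := one_mul _
    _ ≤ c * Real.exp (-c * dist a b) := hK a b hab

/-- **(2.23)+(2.24) ⟹ (2.26), the mechanism with explicit constants**: a cutoff `ζ′ = 1` within `R₁`, `0 ≤ ζ′ ≤ 1`, and the threshold
decay `|C(x,b′)| ≦ ce^{−c dist}` for `dist ≥ c` with `c ≤ R₁` give `|ζ′C − C| ≦ (ce^{−(c/2)R₁})e^{−(c/2)dist}` (r18's `loc_close` needs
decay everywhere; here `ζ′C − C` lives where `dist > R₁ ≥ c`, so (2.23) suffices). [cite: BalabanImbrieJaffe1988, (2.26) p.262] -/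
theorem close_loc_of_decayFar {dist : α → β → ℝ} {ζ K : α → β → ℝ} {R₁ R₀ c : ℝ} (hc : 0 ≤ c) (hcR : c ≤ R₁)
    (hζ : IsCutoff dist ζ R₁ R₀) (h01 : ∀ a b, 0 ≤ ζ a b ∧ ζ a b ≤ 1) (hK : DecayFar dist K c) :
    Close dist (loc ζ K) K (c * Real.exp (-(c / 2) * R₁)) (c / 2) := by
  intro a b
  by_cases hab : dist a b ≤ R₁
  · have h1 := hζ.1 a b hab
    simp only [loc, h1, one_mul, sub_self, abs_zero]
    positivity
  · rw [not_le] at hab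
    have hfac : |loc ζ K a b - K a b| ≤ |K a b| := by
      have : loc ζ K a b - K a b = (ζ a b - 1) * K a b := by simp only [loc]; ring
      rw [this, abs_mul]
      have hz : |ζ a b - 1| ≤ 1 := by
        rw [abs_le]
        constructor <;> linarith [(h01 a b).1, (h01 a b).2]
      calc |ζ a b - 1| * |K a b| ≤ 1 * |K a b| := mul_le_mul_of_nonneg_right hz (abs_nonneg _)
        _ = |K a b| := one_mul _
    refine hfac.trans ((hK a b (by linarith)).trans ?_)
    rw [mul_assoc, ← Real.exp_add]
    gcongr
    nlinarith

/-- **(2.26) at the printed radii** of (2.24) (`Zeta224`: ζ′ = 1 within `¼r(e_k)`), `δ = ce^{−(c/2)·¼r(e_k)}`, rate `c/2` (print: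
`e^{−cr(e_k)}e^{−c dist}` with a generic c). [cite: BalabanImbrieJaffe1988, (2.26) p.262] -/
theorem close226 {dist : α → β → ℝ} {ζ' Ck : α → β → ℝ} {c rek : ℝ} (hc : 0 ≤ c) (hcR : c ≤ rek / 4)
    (hζ : Zeta224 dist rek ζ') (h01 : ∀ a b, 0 ≤ ζ' a b ∧ ζ' a b ≤ 1) (h223 : DecayFar dist Ck c) :
    Close dist (loc ζ' Ck) Ck (c * Real.exp (-(c / 2) * (rek / 4))) (c / 2) :=
  close_loc_of_decayFar hc hcR hζ h01 h223

/-! ## §3 (v1.1)  Everywhere-decay: (I.7.2.2) + (2.4) ⟹ (2.5), and the truncation of a decaying kernel -/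

/-- **(2.5) from (I.7.2.2)**, p. 260: *"Since ζ_k and H_k have good decay properties, so does H_{k,loc}: |H_{k,loc}(b,b′)| ≦ ce^{−c dist(b,b′)};
(2.5) see (I.7.2.2)"* — a cutoff with `0 ≤ ζ ≤ 1` ((2.1)) preserves the everywhere-decay of the kernel, same constant.
[cite: BalabanImbrieJaffe1988, (2.5) p.260] -/
theorem decay_loc {dist : α → β → ℝ} {ζ K : α → β → ℝ} {c : ℝ} (h01 : ∀ a b, 0 ≤ ζ a b ∧ ζ a b ≤ 1)
    (hK : Decay dist K c) : Decay dist (loc ζ K) c := by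
  intro a b
  have hz : |ζ a b| ≤ 1 := by
    rw [abs_le]
    constructor <;> linarith [(h01 a b).1, (h01 a b).2]
  calc |loc ζ K a b| = |ζ a b| * |K a b| := abs_mul _ _
    _ ≤ 1 * |K a b| := mul_le_mul_of_nonneg_right hz (abs_nonneg _)
    _ = |K a b| := one_mul _
    _ ≤ c * Real.exp (-c * dist a b) := hK a b

/-- Everywhere-decay (r18's `Decay`) implies the threshold decay `DecayFar` with the same constant. [cite: BalabanImbrieJaffe1988, (2.16) p.261] -/
theorem decayFar_of_decay {dist : α → β → ℝ} {K : α → β → ℝ} {c : ℝ} (hK : Decay dist K c) : DecayFar dist K c :=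
  fun a b _ => hK a b

/-- The sharp truncation of an everywhere-decaying kernel: `|trunc_R K − K| ≤ (ce^{−(c/2)R})e^{−(c/2)dist}` for any radius `R ≥ c`
(§1 with `DecayFar` supplied by `Decay`). [cite: BalabanImbrieJaffe1988, (2.18) p.262] -/
theorem close_trunc_of_decay {dist : α → β → ℝ} {K : α → β → ℝ} {c R : ℝ} (hc : 0 ≤ c) (hcR : c ≤ R)
    (hK : Decay dist K c) : Close dist (trunc dist R K) K (c * Real.exp (-(c / 2) * R)) (c / 2) :=
  close_trunc_of_decayFar hc hcR (decayFar_of_decay hK)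

end

end Literature.MathematicalPhysics.QuantumFieldTheory.BalabanImbrieJaffe1984to88.BIJ88Close218Proof
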